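import Literature.NumberTheory.Rogawski1990.LocalStableClassesRankTwoOccurs              -- ★ FILE B (this seat): occurrence in every binary form, `S(G, γ) = conjClassesIn`, anisotropic eigenvalues
import Literature.NumberTheory.Automorphic.UnitaryRankTwoCentralizerCompactness           -- ★ FILE A (this seat): rank-2 centraliser compact (type (2)) ∕ not compact (split)
import Literature.NumberTheory.Rogawski1990.LocalStableClassesNonsplitRankTwoIrreducible  -- ★ B-p14: `isConj_of_isStablyConjH_of_irreducible`, `setOf_st_out_eq_singleton`, `conjClassesIn_eq_singleton_of_irreducible_rankTwo`
import Literature.NumberTheory.Rogawski1990.UnitStableOrbitalIntegralHSideCount           -- ★ B-p10: `setOf_st_out_eq_pair`, `two_classes_prod_of_two_classes_fst`, `eq_of_isStablyConj_rankOne`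
import Literature.NumberTheory.Rogawski1990.StableClassesSplitTorus                       -- ★ `isConj_of_isStablyConj_of_splitFrame_two`
import Literature.NumberTheory.Automorphic.RankTwoEigenframeOfSplitCharpoly                -- ★ B-p10 (E1): `exists_eigenframe_of_isRoot_map_of_separable`
import Literature.NumberTheory.Rogawski1990.LocalCentralizerTorusMeasureCM                -- ★ B-p04: `isRegularElt_fst_snd_of_isLocalGRegular`
import Literature.NumberTheory.Rogawski1990.FinExplicitTransferFactor                     -- ★ `finCharpolyTwo`
import Literature.NumberTheory.Automorphic.LocalUnitaryGroupCompactOfAnisotropic           -- ★ `exists_neg_det_eq_norm_of_hermForm_eq_zero`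
import HarnessLib

/-!
# (CNT-b) The compact-side class COUNT of the `N6ns` germ: the `U(G₁′)`-classes with the characteristic polynomial of `γ_H.1` are as many as the `H_v`-stable class of
# `γ_H` when `Z(γ_H.1)` is compact, and none otherwise (Rogawski 1990, §8.1 Prop. 8.1.3 pp. 110–111 «`|ker(H¹(F,T) → H¹(F,I))|`»; §3.5 Prop. 3.5.2, §3.8 Prop. 3.8.1 (d))

Topic `NumberTheory/Rogawski1990`; namespace `Literature.NumberTheory.Rogawski1990`.  THEOREMS ONLY (no definition, no instance, no notation, no named fact, no `sorry`).
Cell `pub/hodgecm-mathlib` (D-0151), crux H413 = `stmt-HodgeConjecture-24833`, floor-2 line «N6nsGerm» (`Cruxes/H413/Lines/F0_P3a_N6nsGerm.lean`, stub `stub_N6nsS1`), binder `hcnt`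
(CNT) of ★ B-p08 `exists_nhds_finsum_side_eq_stableOrbitalIntegralRel_of_compact_dock` (`LocalTransferCompactSideJunctionCM` :202–:211); LEAD F0P3a-plan (g9) WORD T8-120 «(CNT-b)»,
census `B-provers/B-p04/g34/CENSUS-CNTb-CompactSideCount.B-p04g34.md` §2 (n6); interface = F0P3a-p08 (g13)'s (CNT-a) ★ `LocalNormFibreBadFrameClassesCM` ∕ `…Count` (the `Q′`-side of
`hcnt` is in bijection with `{β : ConjClasses ↥U(G₁′) | charpoly (out β) = finCharpolyTwo γ_H}`); seat B-p04 (g34).  HONEST LABEL: HC_CM is proved only modulo the printed citations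
until rung 0 closes; this file is unconditional local algebra ∕ topology and pays no printed letter.

THE MATHEMATICS.  `v` non-split, `H_v = U(Φ₂)_v × U(Φ₁)_v`, `γ_H ∈ H_v` `G`-regular (so `χ := χ_{γ_H.1}` is separable, ★ `isRegularElt_fst_snd_of_isLocalGRegular`), `G₁′ ∈ M₂(L_v)` hermitian
with unit determinant.  TRICHOTOMY (§1): `χ` has a root `u₀ ∈ L_w` with `σ(u₀)u₀ = 1` — ELLIPTIC TYPE (1), eigenframe with both eigenvalues of norm one (★ (E1)); or a root with
`σ(u₀)u₀ ≠ 1` — SPLIT; or no root in `L_w` — TYPE (2) (`χ` irreducible over the field `L_v`).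
* H-SIDE CLASS SET (§2): pair `{⟦γ_H⟧, ⟦γ_H′⟧}` (type (1): ★ `exists_isStablyConj_not_isConj_forall_isConj_or_rankTwo` + ★ `two_classes_prod_of_two_classes_fst` + ★ `setOf_st_out_eq_pair`),
  singleton (type (2): ★ `isConj_of_isStablyConjH_of_irreducible`; split: ★ `isConj_of_isStablyConj_of_splitFrame_two` + rank one) — so it is FINITE for every `G`-regular `γ_H`
  (clause (2) of `hcnt`) with `ncard` `2 ∕ 1 ∕ 1`.
* COMPACT SIDE (§3): `S(G₁′, γ_H) := {β | χ_{out β} = χ}` is `∅` or `conjClassesIn σ G₁′ B` for an occurring `B` (★ FILE B), hence FINITE; an occurring `B` exists in types (1), (2)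
  for EVERY `G₁′` (★ FILE B `exists_mem_unitaryGroup_charpoly_eq_of_eigenframe` ∕ `…_of_forall_eval_ne_zero`), and then `#S = 2 ∕ 1` (★ `ncard_conjClassesIn_eq_two_rankTwo` ∕ ★
  `ncard_conjClassesIn_eq_one_of_irreducible_rankTwo`, the eigenframe of `B` being `gP` for a `GL₂(L_v)`-conjugator `g`, ★ `exists_units_conj_eq_of_charpoly_eq_of_separable`).
* CLAUSE (3): `CompactSpace Z(γ_H.1) → #S = #(H-side)`: `2 = 2`, `1 = 1`, and the split case is VACUOUS (★ FILE A `not_compactSpace_centralizer_cmDatum_two_of_split_eigenframe`).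
* CLAUSE (4): `¬ CompactSpace Z(γ_H.1) → S = ∅` for ANISOTROPIC `G₁′`: types (1), (2) are vacuous (★ (E4) `compactSpace_centralizer_of_eigenframe_of_smul_eq`, ★ FILE A
  `compactSpace_centralizer_cmDatum_two_of_not_exists_isRoot`), and a split class does not occur in an anisotropic form (★ FILE B `forall_map_mul_self_eq_one_of_eigenframe_of_anisotropic`);
  anisotropy is also offered from the determinant class `−det G₁′ ∉ N(L_v^×)` (★ `exists_neg_det_eq_norm_of_hermForm_eq_zero`).

References: [Rogawski1990] §3.5 Prop. 3.5.2 (a)(c) p. 29, §3.6 p. 31, §3.8 Prop. 3.8.1 (d) p. 30, §4.1 (4.1.1) p. 39, §8.1 Prop. 8.1.3 pp. 110–111 · [Kottwitz1986] §7 ·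
[PlatonovRapinchuk1994] §3.3 · [Flicker1998UnitaryFL] §6 p. 95, p. 97 · [Jacobowitz1962] §3.
-/

set_option autoImplicit false

noncomputable section
open NumberField IsDedekindDomain Polynomial
open Matrix hiding mem_unitaryGroup_iff unitaryGroup
open scoped MatrixGroups

namespace Literature.NumberTheory.Rogawski1990

open Literature.NumberTheory.Automorphic Literature.NumberTheory.QuadraticForms
open Literature.NumberTheory.Automorphic.UnitaryGroup hiding hermForm hermForm_apply hermForm_mulVec
open Literature.AlgebraicGeometry.ShimuraVarieties (unitaryGroup mem_unitaryGroup_iff hermForm)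
open Literature.LinearAlgebra.Matrix (exists_units_conj_eq_of_charpoly_eq_of_separable)

section CM

variable (L : Type) [Field L] [NumberField L] [IsCMField L] (v : HeightOneSpectrum (𝓞 ↥(maximalRealSubfield L)))
  (w : PlacesOver L v) (hw : IsCMField.complexConj L • w.1 = w.1)

/-- A CM field has a non-zero element negated by complex conjugation. [cite: Rogawski1990, §1.10] -/
private theorem exists_complexConj_eq_neg_ne_zero_cnt : ∃ δ : L, IsCMField.complexConj L δ = -δ ∧ δ ≠ 0 := by
  obtain ⟨ζ, hζ⟩ := not_forall.1 fun h0 => IsCMField.complexConj_ne_one L (AlgEquiv.ext h0)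
  refine ⟨ζ - IsCMField.complexConj L ζ, by rw [map_sub, IsCMField.complexConj_apply_apply, neg_sub], fun h0 => hζ ?_⟩
  rw [sub_eq_zero] at h0
  exact h0.symm

/-- `(Φ₂)_v` is hermitian for `σ_v`. [cite: Rogawski1990, §1.9 p. 8] -/
private theorem localPhiTwo_herm : ((((adelicForm L 2 (Matrix.of fun i j : Fin 2 => if i.val + j.val + 1 = 2 then (1 : L) else 0)).map (adeleToLocal L v))).map (conjLocal L (IsCMField.complexConj L) v))ᵀ = ((adelicForm L 2 (Matrix.of fun i j : Fin 2 => if i.val + j.val + 1 = 2 then (1 : L) else 0)).map (adeleToLocal L v)) :=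
  map_conjLocal_transpose_localForm L 2 (Matrix.of fun i j : Fin 2 => if i.val + j.val + 1 = 2 then (1 : L) else 0) v (antidiagOne_map_transpose (IsCMField.complexConj L) (N := 2))

omit [IsCMField L] in
/-- `det (Φ₂)_v` is a unit. [cite: Rogawski1990, §1.9 p. 8] -/
private theorem localPhiTwo_det : IsUnit (((adelicForm L 2 (Matrix.of fun i j : Fin 2 => if i.val + j.val + 1 = 2 then (1 : L) else 0)).map (adeleToLocal L v))).det :=
  isUnit_det_localForm L 2 (Matrix.of fun i j : Fin 2 => if i.val + j.val + 1 = 2 then (1 : L) else 0) v (isUnit_antidiagOne_det (L := L) (N := 2)).ne_zero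

/-- `Φ₂` is hermitian over `L` (in the `cmConjRingHom` spelling). [cite: Rogawski1990, §1.9 p. 8] -/
private theorem localPhiTwo_hermL :
    ((Matrix.of fun i j : Fin 2 => if i.val + j.val + 1 = 2 then (1 : L) else 0).map (cmConjRingHom L))ᵀ =
      Matrix.of fun i j : Fin 2 => if i.val + j.val + 1 = 2 then (1 : L) else 0 := by
  rw [map_cmConjRingHom_eq_map_complexConj]
  exact antidiagOne_map_transpose (IsCMField.complexConj L) (N := 2)

/-- For `z` with `ᵗσ(z) G z = G` and `det G` a unit: `σ(det z) · det z = 1`. [folklore] -/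
private theorem map_det_mul_det_eq_one_cnt {K : Type*} [CommRing K] (σ : K →+* K) {n : Type*} [Fintype n] [DecidableEq n] {G : Matrix n n K} (hG : IsUnit G.det)
    {z : Matrix n n K} (hz : (z.map σ)ᵀ * G * z = G) : σ z.det * z.det = 1 := by
  have h := congrArg Matrix.det hz
  rw [Matrix.det_mul, Matrix.det_mul, Matrix.det_transpose, ← RingHom.mapMatrix_apply, ← RingHom.map_det] at h
  have h2 : (σ z.det * z.det) * G.det = 1 * G.det := by rw [one_mul]; linear_combination h
  exact hG.mul_right_cancel h2

/-- **The two eigenvalues of a unitary rank-2 frame have norm one TOGETHER**: `γ ∈ U(H)`, `γ P = P · diag(u)` ⟹ (`σ(u₀) u₀ = 1 ↔ σ(u₁) u₁ = 1`), since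
`N(det γ) = N(u₀) N(u₁) = 1`. [cite: Rogawski1990, §3.6 p. 31] -/
theorem map_mul_self_eq_one_iff_of_eigenframe {K : Type*} [CommRing K] (σ : K →+* K) {H : Matrix (Fin 2) (Fin 2) K} (hHd : IsUnit H.det) {γ : GL (Fin 2) K}
    (hγ : γ ∈ unitaryGroup σ H) {P : GL (Fin 2) K} {u : Fin 2 → K} (hP : γ.val * P.val = P.val * diagonal u) :
    σ (u 0) * u 0 = 1 ↔ σ (u 1) * u 1 = 1 := by
  have hdetγ : σ γ.val.det * γ.val.det = 1 := map_det_mul_det_eq_one_cnt σ hHd ((mem_unitaryGroup_iff (σ := σ) (H := H) (g := γ)).1 hγ)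
  have hdetu : γ.val.det = u 0 * u 1 := by
    have h := congrArg Matrix.det hP
    rw [Matrix.det_mul, Matrix.det_mul, det_diagonal, Fin.prod_univ_two] at h
    have hPd : IsUnit P.val.det := by
      have hh := P.isUnit; rwa [Matrix.isUnit_iff_isUnit_det] at hh
    have h' : P.val.det * γ.val.det = P.val.det * (u 0 * u 1) := by rw [mul_comm P.val.det γ.val.det, h]
    exact hPd.mul_left_cancel h'
  rw [hdetu, map_mul] at hdetγ
  have key : (σ (u 0) * u 0) * (σ (u 1) * u 1) = 1 := by rw [← hdetγ]; ring
  constructor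
  · intro h0; rwa [h0, one_mul] at key
  · intro h1; rwa [h1, mul_one] at key

/-! ## §1 The trichotomy of a regular rank-2 unitary element at a non-split place -/

include hw in
/-- **TRICHOTOMY**: for `γ ∈ U(H)(F_v) ⊂ GL₂(L_v)` (`det H` a unit, `v` non-split) with SEPARABLE characteristic polynomial `χ`, either (type (1)) `γ P = P · diag(u)`, `u` injective,
`σ(uᵢ) uᵢ = 1`; or (split) `γ P = P · diag(u)` with `σ(u₀) u₀ ≠ 1`; or (type (2)) `χ` read at `w` has no root in `L_w`. [cite: Rogawski1990, §3.6 p. 31] -/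
theorem eigenframe_trichotomy_of_separable {H : Matrix (Fin 2) (Fin 2) (LocalRing L v)} (hHd : IsUnit H.det) {γ : GL (Fin 2) (LocalRing L v)} (hγ : γ ∈ unitaryGroup (conjLocal L (IsCMField.complexConj L) v) H)
    (hsep : γ.val.charpoly.Separable) :
    (∃ (P : GL (Fin 2) (LocalRing L v)) (u : Fin 2 → (LocalRing L v)), γ.val * P.val = P.val * diagonal u ∧ Function.Injective u ∧ ∀ i, (conjLocal L (IsCMField.complexConj L) v) (u i) * u i = 1) ∨
    (∃ (P : GL (Fin 2) (LocalRing L v)) (u : Fin 2 → (LocalRing L v)), γ.val * P.val = P.val * diagonal u ∧ Function.Injective u ∧ (conjLocal L (IsCMField.complexConj L) v) (u 0) * u 0 ≠ 1) ∨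
    (¬ ∃ x : w.1.adicCompletion L, ((γ.val.charpoly).map (Pi.evalRingHom (fun w' : PlacesOver L v => w'.1.adicCompletion L) w)).IsRoot x) := by
  letI : Field (LocalRing L v) := (LocalRing.isField_of_smul_eq (IsCMField.complexConj L) (IsCMField.complexConj_ne_one L) w hw).toField
  by_cases hroot : ∃ x : w.1.adicCompletion L, ((γ.val.charpoly).map (Pi.evalRingHom (fun w' : PlacesOver L v => w'.1.adicCompletion L) w)).IsRoot x
  · obtain ⟨α, hα⟩ := hroot
    obtain ⟨P, u, hP, hu, -⟩ := exists_eigenframe_of_isRoot_map_of_separable L v w hw γ hα hsep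
    by_cases h0 : (conjLocal L (IsCMField.complexConj L) v) (u 0) * u 0 = 1
    · refine Or.inl ⟨P, u, hP, hu, fun i => ?_⟩
      fin_cases i
      · exact h0
      · exact (map_mul_self_eq_one_iff_of_eigenframe (conjLocal L (IsCMField.complexConj L) v) hHd hγ hP).1 h0
    · exact Or.inr (Or.inl ⟨P, u, hP, hu, h0⟩)
  · exact Or.inr (Or.inr hroot)

include hw in
/-- Type (2) readings: NO ROOT of `χ.map eval_w` in `L_w` ⟹ `χ` has no root in `L_v` and is IRREDUCIBLE over the field `L_v` (`χ` monic of degree `2`). [cite: Rogawski1990, §3.6 p. 31] -/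
theorem forall_eval_ne_zero_and_irreducible_of_not_exists_isRoot (γ : GL (Fin 2) (LocalRing L v))
    (hroot : ¬ ∃ x : w.1.adicCompletion L, ((γ.val.charpoly).map (Pi.evalRingHom (fun w' : PlacesOver L v => w'.1.adicCompletion L) w)).IsRoot x) :
    (∀ r : (LocalRing L v), γ.val.charpoly.eval r ≠ 0) ∧ Irreducible γ.val.charpoly := by
  letI : Field (LocalRing L v) := (LocalRing.isField_of_smul_eq (IsCMField.complexConj L) (IsCMField.complexConj_ne_one L) w hw).toField
  have hev : ∀ r : (LocalRing L v), γ.val.charpoly.eval r ≠ 0 := fun r hr =>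
    hroot ⟨(Pi.evalRingHom (fun w' : PlacesOver L v => w'.1.adicCompletion L) w) r, by
      rw [Polynomial.IsRoot, Polynomial.eval_map, Polynomial.eval₂_at_apply, hr, map_zero]⟩
  refine ⟨hev, ?_⟩
  have hmon : γ.val.charpoly.Monic := Matrix.charpoly_monic _
  have hdeg : γ.val.charpoly.natDegree = 2 := by rw [Matrix.charpoly_natDegree_eq_dim, Fintype.card_fin]
  rw [hmon.irreducible_iff_roots_eq_zero_of_degree_le_three (by rw [hdeg]) (by rw [hdeg]; norm_num)]
  refine Multiset.eq_zero_of_forall_notMem fun r hr => ?_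
  rw [Polynomial.mem_roots hmon.ne_zero] at hr
  exact hev r hr

/-- **A class set whose members are all conjugate is a singleton.** [cite: Rogawski1990, §4.1 (4.1.1) p. 39] -/
private theorem conjClassesIn_eq_singleton_of_forall_isConj_cnt {K : Type*} [CommRing K] (σ : K →+* K) {n : Type*} [Fintype n] [DecidableEq n] {H : Matrix n n K}
    (γ : unitaryGroup σ H) (hall : ∀ δ : unitaryGroup σ H, IsStablyConj σ H γ δ → IsConj γ δ) :
    conjClassesIn σ H γ = {ConjClasses.mk γ} := by
  ext x
  obtain ⟨δ', rfl⟩ := ConjClasses.mk_surjective x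
  rw [mk_mem_conjClassesIn_iff, Set.mem_singleton_iff, ConjClasses.mk_eq_mk_iff_isConj]
  exact ⟨fun h => (hall δ' h).symm, fun h => isStablyConj_of_isConj h.symm⟩

include hw in
/-- **SPLIT ⇒ ONE CLASS** (`v` non-split, any `H ∈ M₂(L_v)` hermitian with unit determinant): the local stable class of `γ` with a split frame (`σ(u₀) u₀ ≠ 1`) is `{⟦γ⟧}`
(★ `isConj_of_isStablyConj_of_splitFrame_two`). [cite: Rogawski1990, §3.6 p. 31] [cite: Kottwitz1986, §7] -/
theorem conjClassesIn_eq_singleton_of_split {H : Matrix (Fin 2) (Fin 2) (LocalRing L v)} (hH : (H.map (conjLocal L (IsCMField.complexConj L) v))ᵀ = H) (hHd : IsUnit H.det) {γ : GL (Fin 2) (LocalRing L v)}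
    (hγ : γ ∈ unitaryGroup (conjLocal L (IsCMField.complexConj L) v) H) {P : GL (Fin 2) (LocalRing L v)} {u : Fin 2 → (LocalRing L v)} (hP : γ.val * P.val = P.val * diagonal u)
    (h0 : (conjLocal L (IsCMField.complexConj L) v) (u 0) * u 0 ≠ 1) :
    conjClassesIn (conjLocal L (IsCMField.complexConj L) v) H ⟨γ, hγ⟩ = {ConjClasses.mk ⟨γ, hγ⟩} := by
  letI : Field (LocalRing L v) := (LocalRing.isField_of_smul_eq (IsCMField.complexConj L) (IsCMField.complexConj_ne_one L) w hw).toField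
  have hσσ : ∀ x : (LocalRing L v), (conjLocal L (IsCMField.complexConj L) v) ((conjLocal L (IsCMField.complexConj L) v) x) = x := conjLocal_conjLocal (IsCMField.complexConj L) v
    (GelbartRogawski1991.UnitaryDualPair.complexConj_imagUnit L) (GelbartRogawski1991.UnitaryDualPair.imagUnit_ne_zero L)
  have h1 : (conjLocal L (IsCMField.complexConj L) v) (u 1) * u 1 ≠ 1 := fun h1 => h0 ((map_mul_self_eq_one_iff_of_eigenframe (conjLocal L (IsCMField.complexConj L) v) hHd hγ hP).2 h1)
  refine conjClassesIn_eq_singleton_of_forall_isConj_cnt (conjLocal L (IsCMField.complexConj L) v) ⟨γ, hγ⟩ fun δ' hst => ?_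
  exact isConj_of_isStablyConj_of_splitFrame_two (conjLocal L (IsCMField.complexConj L) v) H hσσ hH hHd hst P hP (Ne.isUnit (sub_ne_zero.2 h0)) (Ne.isUnit (sub_ne_zero.2 h1))

include hw in
/-- **THE LOCAL CLASS SET OF A REGULAR RANK-2 ELEMENT IS FINITE** (`v` non-split, any hermitian `H ∈ M₂(L_v)` with unit determinant, `χ_γ` separable): pair (type (1)),
singleton (split, type (2)). [cite: Rogawski1990, §3.5 Prop. 3.5.2 (c) p. 29; §3.6 p. 31] -/
theorem finite_conjClassesIn_of_separable {H : Matrix (Fin 2) (Fin 2) (LocalRing L v)} (hH : (H.map (conjLocal L (IsCMField.complexConj L) v))ᵀ = H) (hHd : IsUnit H.det) {γ : GL (Fin 2) (LocalRing L v)}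
    (hγ : γ ∈ unitaryGroup (conjLocal L (IsCMField.complexConj L) v) H) (hsep : γ.val.charpoly.Separable) : (conjClassesIn (conjLocal L (IsCMField.complexConj L) v) H ⟨γ, hγ⟩).Finite := by
  haveI : Algebra.IsQuadraticExtension ↥(maximalRealSubfield L) L := IsCMField.isQuadraticExtension L
  obtain ⟨δ, hcδ, hδ⟩ := exists_complexConj_eq_neg_ne_zero_cnt L
  rcases eigenframe_trichotomy_of_separable L v w hw hHd hγ hsep with ⟨P, u, hP, hu, hu1⟩ | ⟨P, u, hP, -, h0⟩ | hroot
  · obtain ⟨g, hg, -, hpair, -⟩ := exists_conjClassesIn_eq_pair_rankTwo L v (IsCMField.complexConj L) hcδ hδ w hw hH hHd hγ hP hu hu1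
    rw [hpair]
    exact (Set.finite_singleton _).insert _
  · rw [conjClassesIn_eq_singleton_of_split L v w hw hH hHd hγ hP h0]
    exact Set.finite_singleton _
  · rw [conjClassesIn_eq_singleton_of_irreducible_rankTwo L v (IsCMField.complexConj L) hcδ hδ w hw hH hHd hγ
      (forall_eval_ne_zero_and_irreducible_of_not_exists_isRoot L v w hw γ hroot).2]
    exact Set.finite_singleton _

/-! ## §2 The `H_v`-side: the stable class of a `G`-regular `γ_H` (clause (2) of `hcnt`), natively on the `cmDatum` carriers -/

/-- Membership transfer `unitaryGroup ↝ U(Φ₂)_v` (same defining equation). [folklore] -/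
private theorem mem_local_of_mem_unitaryGroup {x : GL (Fin 2) (LocalRing L v)} (hx : x ∈ unitaryGroup (conjLocal L (IsCMField.complexConj L) v) ((adelicForm L 2 (Matrix.of fun i j : Fin 2 => if i.val + j.val + 1 = 2 then (1 : L) else 0)).map (adeleToLocal L v))) :
    x ∈ «local» L (IsCMField.complexConj L) 2 (Matrix.of fun i j : Fin 2 => if i.val + j.val + 1 = 2 then (1 : L) else 0) v :=
  (mem_unitaryGroupOfForm_iff (σ := (conjLocal L (IsCMField.complexConj L) v)) (J := ((adelicForm L 2 (Matrix.of fun i j : Fin 2 => if i.val + j.val + 1 = 2 then (1 : L) else 0)).map (adeleToLocal L v))) (g := x)).2 ((mem_unitaryGroup_iff (σ := (conjLocal L (IsCMField.complexConj L) v)) (H := ((adelicForm L 2 (Matrix.of fun i j : Fin 2 => if i.val + j.val + 1 = 2 then (1 : L) else 0)).map (adeleToLocal L v))) (g := x)).1 hx)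

include hw in
/-- **SPLIT `γ_H.1` ⇒ every `H_v`-stable conjugate of `γ_H` is conjugate to it** (rank 2: split frame; rank 1: equality). [cite: Rogawski1990, §3.6 p. 31; §3.1 p. 19] -/
theorem isConj_of_isLocalStablyConjH_of_split (γH : ((cmDatum L 2 (Matrix.of fun i j : Fin 2 => if i.val + j.val + 1 = 2 then (1 : L) else 0)).Local v × (cmDatum L 1 (Matrix.of fun i j : Fin 1 => if i.val + j.val + 1 = 1 then (1 : L) else 0)).Local v)) {P : GL (Fin 2) (LocalRing L v)} {u : Fin 2 → (LocalRing L v)}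
    (hP : (γH.1.val : GL (Fin 2) (LocalRing L v)).val * P.val = P.val * diagonal u) (h0 : (conjLocal L (IsCMField.complexConj L) v) (u 0) * u 0 ≠ 1)
    (k : ((cmDatum L 2 (Matrix.of fun i j : Fin 2 => if i.val + j.val + 1 = 2 then (1 : L) else 0)).Local v × (cmDatum L 1 (Matrix.of fun i j : Fin 1 => if i.val + j.val + 1 = 1 then (1 : L) else 0)).Local v)) (hk : IsLocalStablyConjH L v γH k) : IsConj γH k := by
  letI : Field (LocalRing L v) := (LocalRing.isField_of_smul_eq (IsCMField.complexConj L) (IsCMField.complexConj_ne_one L) w hw).toField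
  have hσσ : ∀ x : (LocalRing L v), (conjLocal L (IsCMField.complexConj L) v) ((conjLocal L (IsCMField.complexConj L) v) x) = x := conjLocal_conjLocal (IsCMField.complexConj L) v
    (GelbartRogawski1991.UnitaryDualPair.complexConj_imagUnit L) (GelbartRogawski1991.UnitaryDualPair.imagUnit_ne_zero L)
  have h1 : (conjLocal L (IsCMField.complexConj L) v) (u 1) * u 1 ≠ 1 := fun h1 => h0 ((map_mul_self_eq_one_iff_of_eigenframe (conjLocal L (IsCMField.complexConj L) v) (localPhiTwo_det L v) γH.1.2 hP).2 h1)
  have hc1 : IsConj γH.1 k.1 := by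
    have h := isConj_of_isStablyConj_of_splitFrame_two (conjLocal L (IsCMField.complexConj L) v) _ hσσ (localPhiTwo_herm L v) (localPhiTwo_det L v) hk.1 P hP
      (Ne.isUnit (sub_ne_zero.2 h0)) (Ne.isUnit (sub_ne_zero.2 h1))
    exact h
  have h2 : γH.2 = k.2 := eq_of_isStablyConj_rankOne (conjLocal L (IsCMField.complexConj L) v) _ hk.2
  obtain ⟨c, hc⟩ := isConj_iff.1 hc1
  exact isConj_iff.2 ⟨(c, 1), Prod.ext (by simpa using hc) (by simpa using h2)⟩

include hw in
/-- **TYPE (2) `γ_H.1` ⇒ every `H_v`-stable conjugate of `γ_H` is conjugate to it** (rank 2: ★ `isConj_of_isStablyConj_of_irreducible_rankTwo`; rank 1: equality).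
[cite: Rogawski1990, §3.6 p. 31; §3.1 p. 19] [cite: Flicker1998UnitaryFL, p. 97] -/
theorem isConj_of_isLocalStablyConjH_of_not_exists_isRoot (γH : ((cmDatum L 2 (Matrix.of fun i j : Fin 2 => if i.val + j.val + 1 = 2 then (1 : L) else 0)).Local v × (cmDatum L 1 (Matrix.of fun i j : Fin 1 => if i.val + j.val + 1 = 1 then (1 : L) else 0)).Local v))
    (hroot : ¬ ∃ x : w.1.adicCompletion L, (((γH.1.val : GL (Fin 2) (LocalRing L v)).val.charpoly).map (Pi.evalRingHom (fun w' : PlacesOver L v => w'.1.adicCompletion L) w)).IsRoot x)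
    (k : ((cmDatum L 2 (Matrix.of fun i j : Fin 2 => if i.val + j.val + 1 = 2 then (1 : L) else 0)).Local v × (cmDatum L 1 (Matrix.of fun i j : Fin 1 => if i.val + j.val + 1 = 1 then (1 : L) else 0)).Local v)) (hk : IsLocalStablyConjH L v γH k) : IsConj γH k := by
  haveI : Algebra.IsQuadraticExtension ↥(maximalRealSubfield L) L := IsCMField.isQuadraticExtension L
  obtain ⟨δ, hcδ, hδ⟩ := exists_complexConj_eq_neg_ne_zero_cnt L
  have hirr := (forall_eval_ne_zero_and_irreducible_of_not_exists_isRoot L v w hw (γH.1.val : GL (Fin 2) (LocalRing L v)) hroot).2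
  have hc1 : IsConj γH.1 k.1 := by
    have h := isConj_of_isStablyConj_of_irreducible_rankTwo L v (IsCMField.complexConj L) hcδ hδ w hw (localPhiTwo_herm L v) (localPhiTwo_det L v) γH.1.2 hirr _ hk.1
    exact h
  have h2 : γH.2 = k.2 := eq_of_isStablyConj_rankOne (conjLocal L (IsCMField.complexConj L) v) _ hk.2
  obtain ⟨c, hc⟩ := isConj_iff.1 hc1
  exact isConj_iff.2 ⟨(c, 1), Prod.ext (by simpa using hc) (by simpa using h2)⟩

include hw in
/-- **TYPE (1) `γ_H.1` ⇒ the `H_v`-stable class of `γ_H` is EXACTLY TWO conjugacy classes** (the rank-2 datum ★ `exists_isStablyConj_not_isConj_forall_isConj_or_rankTwo` lifted with the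
rank-1 equality; the second class is `(g γ_H.1 g⁻¹, γ_H.2)`). [cite: Rogawski1990, §3.5 Prop. 3.5.2 (c) p. 29; §3.1 p. 19] [cite: Flicker1998UnitaryFL, §6 p. 95] -/
theorem exists_twoClasses_of_eigenframe (γH : ((cmDatum L 2 (Matrix.of fun i j : Fin 2 => if i.val + j.val + 1 = 2 then (1 : L) else 0)).Local v × (cmDatum L 1 (Matrix.of fun i j : Fin 1 => if i.val + j.val + 1 = 1 then (1 : L) else 0)).Local v)) {P : GL (Fin 2) (LocalRing L v)} {u : Fin 2 → (LocalRing L v)}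
    (hP : (γH.1.val : GL (Fin 2) (LocalRing L v)).val * P.val = P.val * diagonal u) (hu : Function.Injective u) (hu1 : ∀ i, (conjLocal L (IsCMField.complexConj L) v) (u i) * u i = 1) :
    ∃ γH' : ((cmDatum L 2 (Matrix.of fun i j : Fin 2 => if i.val + j.val + 1 = 2 then (1 : L) else 0)).Local v × (cmDatum L 1 (Matrix.of fun i j : Fin 1 => if i.val + j.val + 1 = 1 then (1 : L) else 0)).Local v), IsLocalStablyConjH L v γH γH' ∧ ¬ IsConj γH γH' ∧ ∀ k : ((cmDatum L 2 (Matrix.of fun i j : Fin 2 => if i.val + j.val + 1 = 2 then (1 : L) else 0)).Local v × (cmDatum L 1 (Matrix.of fun i j : Fin 1 => if i.val + j.val + 1 = 1 then (1 : L) else 0)).Local v), IsLocalStablyConjH L v γH k → IsConj γH k ∨ IsConj γH' k := by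
  haveI : Algebra.IsQuadraticExtension ↥(maximalRealSubfield L) L := IsCMField.isQuadraticExtension L
  obtain ⟨δ, hcδ, hδ⟩ := exists_complexConj_eq_neg_ne_zero_cnt L
  obtain ⟨g, hg, -, hst, hnc, hall⟩ := exists_isStablyConj_not_isConj_forall_isConj_or_rankTwo L v (IsCMField.complexConj L) hcδ hδ w hw
    (localPhiTwo_herm L v) (localPhiTwo_det L v) γH.1.2 hP hu hu1
  set γ₂' : (cmDatum L 2 (Matrix.of fun i j : Fin 2 => if i.val + j.val + 1 = 2 then (1 : L) else 0)).Local v := ⟨g * (γH.1.val : GL (Fin 2) (LocalRing L v)) * g⁻¹, mem_local_of_mem_unitaryGroup L v hg⟩ with hγ₂'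
  have hst' : IsStablyConj (conjLocal L (IsCMField.complexConj L) v) ((adelicForm L 2 (Matrix.of fun i j : Fin 2 => if i.val + j.val + 1 = 2 then (1 : L) else 0)).map (adeleToLocal L v)) γH.1 γ₂' := by
    have h := hst
    exact h
  have hnc' : ¬ IsConj γH.1 γ₂' := fun h => hnc (by have h' := h; exact h')
  have hall' : ∀ δ' : (cmDatum L 2 (Matrix.of fun i j : Fin 2 => if i.val + j.val + 1 = 2 then (1 : L) else 0)).Local v, IsStablyConj (conjLocal L (IsCMField.complexConj L) v) ((adelicForm L 2 (Matrix.of fun i j : Fin 2 => if i.val + j.val + 1 = 2 then (1 : L) else 0)).map (adeleToLocal L v)) γH.1 δ' → IsConj γH.1 δ' ∨ IsConj γ₂' δ' := fun δ' hδ' => by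
    have h := hall ⟨δ'.val, (mem_unitaryGroup_iff (σ := (conjLocal L (IsCMField.complexConj L) v)) (H := ((adelicForm L 2 (Matrix.of fun i j : Fin 2 => if i.val + j.val + 1 = 2 then (1 : L) else 0)).map (adeleToLocal L v))) (g := δ'.val)).2
      ((mem_unitaryGroupOfForm_iff (σ := (conjLocal L (IsCMField.complexConj L) v)) (J := ((adelicForm L 2 (Matrix.of fun i j : Fin 2 => if i.val + j.val + 1 = 2 then (1 : L) else 0)).map (adeleToLocal L v))) (g := δ'.val)).1 δ'.2)⟩ hδ'
    exact h
  refine ⟨(γ₂', γH.2), ⟨hst', IsStablyConj.refl _⟩, fun h => hnc' ?_, fun k hk => ?_⟩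
  · obtain ⟨c, hc⟩ := isConj_iff.1 h
    exact isConj_iff.2 ⟨c.1, by simpa using congrArg Prod.fst hc⟩
  · have h2 : γH.2 = k.2 := eq_of_isStablyConj_rankOne (conjLocal L (IsCMField.complexConj L) v) _ hk.2
    rcases hall' k.1 hk.1 with h1 | h1
    · obtain ⟨c, hc⟩ := isConj_iff.1 h1
      exact Or.inl (isConj_iff.2 ⟨(c, 1), Prod.ext (by simpa using hc) (by simpa using h2)⟩)
    · obtain ⟨c, hc⟩ := isConj_iff.1 h1
      exact Or.inr (isConj_iff.2 ⟨(c, 1), Prod.ext (by simpa using hc) (by simpa using h2)⟩)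

include hw in
/-- **THE `H_v`-STABLE CLASS SET OF A `G`-REGULAR `γ_H`, BY TYPE**: a pair of distinct classes (type (1)) or the singleton `{⟦γ_H⟧}` (split, type (2)).
[cite: Rogawski1990, §3.5 Prop. 3.5.2 (c) p. 29; §3.6 p. 31] -/
theorem setOf_isLocalStablyConjH_out_eq_pair_or_singleton (γH : ((cmDatum L 2 (Matrix.of fun i j : Fin 2 => if i.val + j.val + 1 = 2 then (1 : L) else 0)).Local v × (cmDatum L 1 (Matrix.of fun i j : Fin 1 => if i.val + j.val + 1 = 1 then (1 : L) else 0)).Local v)) (hreg : IsLocalGRegular L v γH) :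
    (∃ γH' : ((cmDatum L 2 (Matrix.of fun i j : Fin 2 => if i.val + j.val + 1 = 2 then (1 : L) else 0)).Local v × (cmDatum L 1 (Matrix.of fun i j : Fin 1 => if i.val + j.val + 1 = 1 then (1 : L) else 0)).Local v), ConjClasses.mk γH ≠ ConjClasses.mk γH' ∧
        {d : ConjClasses ((cmDatum L 2 (Matrix.of fun i j : Fin 2 => if i.val + j.val + 1 = 2 then (1 : L) else 0)).Local v × (cmDatum L 1 (Matrix.of fun i j : Fin 1 => if i.val + j.val + 1 = 1 then (1 : L) else 0)).Local v) | IsLocalStablyConjH L v γH (Quotient.out d)} = {ConjClasses.mk γH, ConjClasses.mk γH'}) ∨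
      {d : ConjClasses ((cmDatum L 2 (Matrix.of fun i j : Fin 2 => if i.val + j.val + 1 = 2 then (1 : L) else 0)).Local v × (cmDatum L 1 (Matrix.of fun i j : Fin 1 => if i.val + j.val + 1 = 1 then (1 : L) else 0)).Local v) | IsLocalStablyConjH L v γH (Quotient.out d)} = {ConjClasses.mk γH} := by
  have hsep : (γH.1.val : GL (Fin 2) (LocalRing L v)).val.charpoly.Separable := (isRegularElt_fst_snd_of_isLocalGRegular L v γH hreg).1
  have hrefl : ∀ b : ((cmDatum L 2 (Matrix.of fun i j : Fin 2 => if i.val + j.val + 1 = 2 then (1 : L) else 0)).Local v × (cmDatum L 1 (Matrix.of fun i j : Fin 1 => if i.val + j.val + 1 = 1 then (1 : L) else 0)).Local v), IsConj γH b → IsLocalStablyConjH L v γH b := fun _ h => isStablyConjH_of_isConj h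
  have hconj : ∀ (b y : ((cmDatum L 2 (Matrix.of fun i j : Fin 2 => if i.val + j.val + 1 = 2 then (1 : L) else 0)).Local v × (cmDatum L 1 (Matrix.of fun i j : Fin 1 => if i.val + j.val + 1 = 1 then (1 : L) else 0)).Local v)), IsLocalStablyConjH L v γH b → IsLocalStablyConjH L v γH (y * b * y⁻¹) :=
    fun b y hb => hb.trans (isStablyConjH_of_isConj (isConj_iff.2 ⟨y, rfl⟩))
  rcases eigenframe_trichotomy_of_separable L v w hw (localPhiTwo_det L v) γH.1.2 hsep with ⟨P, u, hP, hu, hu1⟩ | ⟨P, u, hP, -, h0⟩ | hroot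
  · obtain ⟨γH', hst, hnc, hall⟩ := exists_twoClasses_of_eigenframe L v w hw γH hP hu hu1
    exact Or.inl ⟨γH', fun h => hnc (ConjClasses.mk_eq_mk_iff_isConj.1 h), setOf_st_out_eq_pair (IsLocalStablyConjH L v) γH γH' hrefl hconj hst hall⟩
  · exact Or.inr (setOf_st_out_eq_singleton (IsLocalStablyConjH L v) γH hrefl (isConj_of_isLocalStablyConjH_of_split L v w hw γH hP h0))
  · exact Or.inr (setOf_st_out_eq_singleton (IsLocalStablyConjH L v) γH hrefl (isConj_of_isLocalStablyConjH_of_not_exists_isRoot L v w hw γH hroot))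

include hw in
/-- **CLAUSE (2) OF `hcnt`: THE `H_v`-STABLE CLASS OF A `G`-REGULAR `γ_H` IS A FINITE SET OF CLASSES.** [cite: Rogawski1990, §3.5 Prop. 3.5.2 (c) p. 29; §8.1 Prop. 8.1.3 p. 110] -/
theorem finite_setOf_isLocalStablyConjH_out (γH : ((cmDatum L 2 (Matrix.of fun i j : Fin 2 => if i.val + j.val + 1 = 2 then (1 : L) else 0)).Local v × (cmDatum L 1 (Matrix.of fun i j : Fin 1 => if i.val + j.val + 1 = 1 then (1 : L) else 0)).Local v)) (hreg : IsLocalGRegular L v γH) :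
    {d : ConjClasses ((cmDatum L 2 (Matrix.of fun i j : Fin 2 => if i.val + j.val + 1 = 2 then (1 : L) else 0)).Local v × (cmDatum L 1 (Matrix.of fun i j : Fin 1 => if i.val + j.val + 1 = 1 then (1 : L) else 0)).Local v) | IsLocalStablyConjH L v γH (Quotient.out d)}.Finite := by
  rcases setOf_isLocalStablyConjH_out_eq_pair_or_singleton L v w hw γH hreg with ⟨γH', -, h⟩ | h
  · rw [h]; exact (Set.finite_singleton _).insert _
  · rw [h]; exact Set.finite_singleton _

/-! ## §3 The compact side `S(G₁′, γ_H)` and clauses (3), (4) of `hcnt` -/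

variable {G₁ : Matrix (Fin 2) (Fin 2) (LocalRing L v)}

omit [IsCMField L] in
/-- An eigenframe TRANSPORTS along equal separable characteristic polynomials: `χ_B = χ_γ`, `γ P = P · diag(u)` ⟹ `B (gP) = (gP) · diag(u)` for a `GL₂(L_v)`-conjugator `g`
(★ `exists_units_conj_eq_of_charpoly_eq_of_separable`). [cite: Rogawski1990, §3.1 p. 19] -/
theorem exists_eigenframe_of_charpoly_eq {γ B : GL (Fin 2) (LocalRing L v)} (hsep : γ.val.charpoly.Separable) (hχ : B.val.charpoly = γ.val.charpoly)
    {P : GL (Fin 2) (LocalRing L v)} {u : Fin 2 → (LocalRing L v)} (hP : γ.val * P.val = P.val * diagonal u) :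
    ∃ P' : GL (Fin 2) (LocalRing L v), B.val * P'.val = P'.val * diagonal u := by
  obtain ⟨g, hg⟩ := exists_units_conj_eq_of_charpoly_eq_of_separable (K := fun w' : PlacesOver L v => w'.1.adicCompletion L) γ B hsep hχ
  refine ⟨g * P, ?_⟩
  rw [← hg]
  calc (g * γ * g⁻¹).val * (g * P).val = (g * γ * g⁻¹ * (g * P)).val := (Units.val_mul _ _).symm
    _ = (g * (γ * P)).val := by rw [show g * γ * g⁻¹ * (g * P) = g * (γ * P) by group]
    _ = g.val * (γ.val * P.val) := by rw [Units.val_mul, Units.val_mul]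
    _ = g.val * (P.val * diagonal u) := by rw [hP]
    _ = (g * P).val * diagonal u := by rw [Units.val_mul, Matrix.mul_assoc]

include hw in
/-- **`S(G₁′, γ_H)` IS FINITE** for every `G`-regular `γ_H` and every hermitian `G₁′ ∈ M₂(L_v)` with unit determinant (clause (1) of `hcnt` through the (CNT-a) bijection).
[cite: Rogawski1990, §3.5 Prop. 3.5.2 (c) p. 29; §8.1 Prop. 8.1.3 p. 110] -/
theorem finite_setOf_charpoly_out_eq_finCharpolyTwo (hG₁ : (G₁.map (conjLocal L (IsCMField.complexConj L) v))ᵀ = G₁) (hG₁d : IsUnit G₁.det) (γH : ((cmDatum L 2 (Matrix.of fun i j : Fin 2 => if i.val + j.val + 1 = 2 then (1 : L) else 0)).Local v × (cmDatum L 1 (Matrix.of fun i j : Fin 1 => if i.val + j.val + 1 = 1 then (1 : L) else 0)).Local v)) (hreg : IsLocalGRegular L v γH) :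
    {β : ConjClasses (unitaryGroup (conjLocal L (IsCMField.complexConj L) v) G₁) | (Quotient.out β).val.val.charpoly = finCharpolyTwo L v γH}.Finite := by
  have hsep : (γH.1.val : GL (Fin 2) (LocalRing L v)).val.charpoly.Separable := (isRegularElt_fst_snd_of_isLocalGRegular L v γH hreg).1
  by_cases hex : ∃ B : unitaryGroup (conjLocal L (IsCMField.complexConj L) v) G₁, B.val.val.charpoly = finCharpolyTwo L v γH
  · obtain ⟨B, hB⟩ := hex
    rw [setOf_charpoly_out_eq_eq_conjClassesIn_of_charpoly_eq L v (IsCMField.complexConj L) G₁ (finCharpolyTwo L v γH) hsep B hB]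
    have hsepB : B.val.val.charpoly.Separable := by rw [hB]; exact hsep
    have h := finite_conjClassesIn_of_separable L v w hw hG₁ hG₁d B.2 hsepB
    exact h
  · push Not at hex
    rw [setOf_charpoly_out_eq_eq_empty L v (IsCMField.complexConj L) G₁ (finCharpolyTwo L v γH) hex]
    exact Set.finite_empty

include hw in
/-- **CLAUSE (3) OF `hcnt`: `Z(γ_H.1)` COMPACT ⟹ `#S(G₁′, γ_H) = #(H_v-stable class of γ_H)`** — for EVERY hermitian `G₁′ ∈ M₂(L_v)` with unit determinant: type (1) `2 = 2`, type (2)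
`1 = 1` (the classes OCCUR in `U(G₁′)`, ★ FILE B), split VACUOUS (★ FILE A). [cite: Rogawski1990, §8.1 Prop. 8.1.3 pp. 110–111; §3.5 Prop. 3.5.2 (c) p. 29] -/
theorem ncard_setOf_charpoly_out_eq_eq_ncard_of_compactSpace (hG₁ : (G₁.map (conjLocal L (IsCMField.complexConj L) v))ᵀ = G₁) (hG₁d : IsUnit G₁.det) (γH : ((cmDatum L 2 (Matrix.of fun i j : Fin 2 => if i.val + j.val + 1 = 2 then (1 : L) else 0)).Local v × (cmDatum L 1 (Matrix.of fun i j : Fin 1 => if i.val + j.val + 1 = 1 then (1 : L) else 0)).Local v)) (hreg : IsLocalGRegular L v γH)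
    (hZ : CompactSpace (Subgroup.centralizer ({γH.1} : Set ((cmDatum L 2 (Matrix.of fun i j : Fin 2 => if i.val + j.val + 1 = 2 then (1 : L) else 0)).Local v)))) :
    {β : ConjClasses (unitaryGroup (conjLocal L (IsCMField.complexConj L) v) G₁) | (Quotient.out β).val.val.charpoly = finCharpolyTwo L v γH}.ncard =
      {d : ConjClasses ((cmDatum L 2 (Matrix.of fun i j : Fin 2 => if i.val + j.val + 1 = 2 then (1 : L) else 0)).Local v × (cmDatum L 1 (Matrix.of fun i j : Fin 1 => if i.val + j.val + 1 = 1 then (1 : L) else 0)).Local v) | IsLocalStablyConjH L v γH (Quotient.out d)}.ncard := by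
  haveI : Algebra.IsQuadraticExtension ↥(maximalRealSubfield L) L := IsCMField.isQuadraticExtension L
  obtain ⟨δ, hcδ, hδ⟩ := exists_complexConj_eq_neg_ne_zero_cnt L
  have hsep : (γH.1.val : GL (Fin 2) (LocalRing L v)).val.charpoly.Separable := (isRegularElt_fst_snd_of_isLocalGRegular L v γH hreg).1
  have hrefl : ∀ b : ((cmDatum L 2 (Matrix.of fun i j : Fin 2 => if i.val + j.val + 1 = 2 then (1 : L) else 0)).Local v × (cmDatum L 1 (Matrix.of fun i j : Fin 1 => if i.val + j.val + 1 = 1 then (1 : L) else 0)).Local v), IsConj γH b → IsLocalStablyConjH L v γH b := fun _ h => isStablyConjH_of_isConj h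
  have hconj : ∀ (b y : ((cmDatum L 2 (Matrix.of fun i j : Fin 2 => if i.val + j.val + 1 = 2 then (1 : L) else 0)).Local v × (cmDatum L 1 (Matrix.of fun i j : Fin 1 => if i.val + j.val + 1 = 1 then (1 : L) else 0)).Local v)), IsLocalStablyConjH L v γH b → IsLocalStablyConjH L v γH (y * b * y⁻¹) :=
    fun b y hb => hb.trans (isStablyConjH_of_isConj (isConj_iff.2 ⟨y, rfl⟩))
  have hχ : finCharpolyTwo L v γH = (γH.1.val : GL (Fin 2) (LocalRing L v)).val.charpoly := rfl
  rcases eigenframe_trichotomy_of_separable L v w hw (localPhiTwo_det L v) γH.1.2 hsep with ⟨P, u, hP, hu, hu1⟩ | ⟨P, u, hP, -, h0⟩ | hroot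
  · obtain ⟨γH', hst, hnc, hall⟩ := exists_twoClasses_of_eigenframe L v w hw γH hP hu hu1
    rw [setOf_st_out_eq_pair (IsLocalStablyConjH L v) γH γH' hrefl hconj hst hall,
      Set.ncard_pair (fun h => hnc (ConjClasses.mk_eq_mk_iff_isConj.1 h))]
    obtain ⟨B, hBU, hBχ⟩ := exists_mem_unitaryGroup_charpoly_eq_of_eigenframe L v (IsCMField.complexConj L) hcδ hδ w hw (localPhiTwo_herm L v) (localPhiTwo_det L v)
      hG₁ hG₁d γH.1.2 hP hu hu1
    rw [setOf_charpoly_out_eq_eq_conjClassesIn_of_charpoly_eq L v (IsCMField.complexConj L) G₁ (finCharpolyTwo L v γH) hsep ⟨B, hBU⟩ (hBχ.trans hχ.symm)]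
    obtain ⟨P', hP'⟩ := exists_eigenframe_of_charpoly_eq L v hsep hBχ hP
    exact ncard_conjClassesIn_eq_two_rankTwo L v (IsCMField.complexConj L) hcδ hδ w hw hG₁ hG₁d hBU hP' hu hu1
  · exact absurd hZ (not_compactSpace_centralizer_cmDatum_two_of_split_eigenframe L v w hw
      (localPhiTwo_hermL L) (isUnit_antidiagOne_det (L := L) (N := 2)).ne_zero γH.1 hP h0)
  · obtain ⟨hev, hirr⟩ := forall_eval_ne_zero_and_irreducible_of_not_exists_isRoot L v w hw (γH.1.val : GL (Fin 2) (LocalRing L v)) hroot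
    rw [setOf_st_out_eq_singleton (IsLocalStablyConjH L v) γH hrefl (isConj_of_isLocalStablyConjH_of_not_exists_isRoot L v w hw γH hroot), Set.ncard_singleton]
    obtain ⟨B, hBU, hBχ⟩ := exists_mem_unitaryGroup_charpoly_eq_of_forall_eval_ne_zero L v (IsCMField.complexConj L) hcδ hδ w hw (localPhiTwo_herm L v)
      (localPhiTwo_det L v) hG₁ hG₁d γH.1.2 hev
    rw [setOf_charpoly_out_eq_eq_conjClassesIn_of_charpoly_eq L v (IsCMField.complexConj L) G₁ (finCharpolyTwo L v γH) hsep ⟨B, hBU⟩ (hBχ.trans hχ.symm)]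
    have hirrB : Irreducible B.val.charpoly := by rw [hBχ]; exact hirr
    exact ncard_conjClassesIn_eq_one_of_irreducible_rankTwo L v (IsCMField.complexConj L) hcδ hδ w hw hG₁ hG₁d hBU hirrB

include hw in
/-- **CLAUSE (4) OF `hcnt` (anisotropic `G₁′`): `Z(γ_H.1)` NOT COMPACT ⟹ NO element of `U(G₁′)(F_v)` has the characteristic polynomial of `γ_H.1`** — types (1), (2) are vacuous
(compact centralisers, ★ (E4) and ★ FILE A), and a split class does not occur in an anisotropic form (★ FILE B). [cite: Rogawski1990, §8.1 Prop. 8.1.3 pp. 110–111; §3.8 Prop. 3.8.1 (d) p. 30] -/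
theorem forall_charpoly_ne_finCharpolyTwo_of_not_compactSpace (hanis : ∀ x : Fin 2 → (LocalRing L v), hermForm (conjLocal L (IsCMField.complexConj L) v) G₁ x x = 0 → x = 0)
    (γH : ((cmDatum L 2 (Matrix.of fun i j : Fin 2 => if i.val + j.val + 1 = 2 then (1 : L) else 0)).Local v × (cmDatum L 1 (Matrix.of fun i j : Fin 1 => if i.val + j.val + 1 = 1 then (1 : L) else 0)).Local v)) (hreg : IsLocalGRegular L v γH) (hZ : ¬ CompactSpace (Subgroup.centralizer ({γH.1} : Set ((cmDatum L 2 (Matrix.of fun i j : Fin 2 => if i.val + j.val + 1 = 2 then (1 : L) else 0)).Local v)))) :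
    ∀ B : unitaryGroup (conjLocal L (IsCMField.complexConj L) v) G₁, B.val.val.charpoly ≠ finCharpolyTwo L v γH := by
  letI : Field (LocalRing L v) := (LocalRing.isField_of_smul_eq (IsCMField.complexConj L) (IsCMField.complexConj_ne_one L) w hw).toField
  have hsep : (γH.1.val : GL (Fin 2) (LocalRing L v)).val.charpoly.Separable := (isRegularElt_fst_snd_of_isLocalGRegular L v γH hreg).1
  have hχ : finCharpolyTwo L v γH = (γH.1.val : GL (Fin 2) (LocalRing L v)).val.charpoly := rfl
  intro B hB
  rcases eigenframe_trichotomy_of_separable L v w hw (localPhiTwo_det L v) γH.1.2 hsep with ⟨P, u, hP, hu, hu1⟩ | ⟨P, u, hP, -, h0⟩ | hroot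
  · exact hZ (compactSpace_centralizer_of_eigenframe_of_smul_eq L w hw _ (localPhiTwo_hermL L)
      (isUnit_antidiagOne_det (L := L) (N := 2)).ne_zero γH.1 hP hu hu1)
  · obtain ⟨P', hP'⟩ := exists_eigenframe_of_charpoly_eq L v hsep (hB.trans hχ) hP
    exact h0 (forall_map_mul_self_eq_one_of_eigenframe_of_anisotropic (conjLocal L (IsCMField.complexConj L) v) G₁ hanis B.2 hP' 0)
  · exact hZ (compactSpace_centralizer_cmDatum_two_of_not_exists_isRoot L v w hw (isUnit_antidiagOne_det (L := L) (N := 2)).ne_zero γH.1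
      (by rw [Matrix.charpoly_map]; exact hroot))

include hw in
/-- **ANISOTROPY FROM THE DETERMINANT CLASS** (rank 2, `v` non-split): if `det G₁′` is a unit and `−det G₁′` is NOT a norm then `G₁′` is anisotropic — the token of ★ (CNT-a)'s bad
frame (`det G₁′ ∉ det G₁ · N` with `G₁ ≅ Φ₂` isotropic) feeds the previous theorem through this. [cite: Rogawski1990, §3.8 Prop. 3.8.1 (d) p. 30] [cite: Jacobowitz1962, §3] -/
theorem anisotropic_of_neg_det_not_norm (hG₁ : (G₁.map (conjLocal L (IsCMField.complexConj L) v))ᵀ = G₁) (hG₁d : IsUnit G₁.det)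
    (hnn : ¬ ∃ z : (LocalRing L v), IsUnit z ∧ -G₁.det = (conjLocal L (IsCMField.complexConj L) v) z * z) :
    ∀ x : Fin 2 → (LocalRing L v), hermForm (conjLocal L (IsCMField.complexConj L) v) G₁ x x = 0 → x = 0 := by
  letI : Field (LocalRing L v) := (LocalRing.isField_of_smul_eq (IsCMField.complexConj L) (IsCMField.complexConj_ne_one L) w hw).toField
  intro x hx
  by_contra hx0
  have h00 : (conjLocal L (IsCMField.complexConj L) v) (G₁ 0 0) = G₁ 0 0 := by
    have h := congrFun (congrFun hG₁ 0) 0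
    rwa [Matrix.transpose_apply, Matrix.map_apply] at h
  have h10 : G₁ 1 0 = (conjLocal L (IsCMField.complexConj L) v) (G₁ 0 1) := by
    have h := congrFun (congrFun hG₁ 1) 0
    rw [Matrix.transpose_apply, Matrix.map_apply] at h
    exact h.symm
  have hN : ∀ s : (LocalRing L v), (conjLocal L (IsCMField.complexConj L) v) s * s = 0 → s = 0 := fun s hs => by
    rcases mul_eq_zero.1 hs with h | h
    · exact (map_eq_zero_iff _ (RingHom.injective _)).1 h
    · exact h
  obtain ⟨z, hz⟩ := exists_neg_det_eq_norm_of_hermForm_eq_zero (conjLocal L (IsCMField.complexConj L) v) (fun s hs => Ne.isUnit hs) hN h00 h10 hx0 hx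
  refine hnn ⟨z, Ne.isUnit ?_, hz⟩
  intro hz0
  rw [hz0, mul_zero, neg_eq_zero] at hz
  exact hG₁d.ne_zero hz

end CM

end Literature.NumberTheory.Rogawski1990
end
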